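import Summits.NavierStokesRegularity.NavierStokesRegularity.Theorems.ScaledTopAlignmentNearMaxMostTimesGlueKit
import Summits.NavierStokesRegularity.NavierStokesRegularity.Theorems.ScaledTopAlignmentNearMaxMostTimesRung
import Summits.NavierStokesRegularity.NavierStokesRegularity.Theorems.ScaledTopAlignmentMostTimesHardCoreMeet
import Summits.NavierStokesRegularity.NavierStokesRegularity.Theses.ScaledTopAlignment
import Summits.NavierStokesRegularity.NavierStokesRegularity.Theses.ThreadingFlux
import Literature.Analysis.FluidPDE.VorticityCalculus
import HarnessLib

/-!
# Route `ScaledTopAlignment`, crux W3ᵐᵗ = `AprioriMostTimesBulkAlignment` (stmt-NavierStokesRegularity-19551),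
# registered line `nearmax` (`Cruxes/AprioriMostTimesBulkAlignment/Lines/nearmax.lean`): the open stub
# `stub_nearMaxMostTimes` (door W3ⁿᵐ) FROM THE UNIVERSAL NEAR-MAX LAWS of the cell planner — kernel glue

The cell planner's ROUND-10 «law calculus» (nsreg-p3, `round-10/Law10-rev2.lean`; crux idea
`Cruxes/AprioriMostTimesBulkAlignment/Ideas/universal-gate-law.md`) replaces the per-solution threshold `∃ M`
of the door W3ⁿᵐ by a UNIVERSAL amplification gate `A(q, ε, δ) · m₀` (`m₀` a bound of the initial vorticity)
and drops the rate premise: the resulting closed, scale-invariant statement about ALL classical Leray–Hopf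
flows from rapidly decaying data — the **universal amplified-window alignment law (UAW, Form T)** — has content
on regular flows and is refutable by certified numerics on a single computable flow. This file puts the
planner's kernel-checked cell theorems into the tree, BY NAME against the registered parent:

* `exists_bound_curl_of_rapidDecay` — rapidly decaying data have bounded vorticity;
* `nearMaxMostTimesDoor_of_universalAmplifiedWindowAlignment` — **UAW ⇒ STUB 1**: the law (stated inline,
  verbatim the body of the planner's `UniversalAmplifiedWindowAlignment`) implies the registered stub
  `Nearmax.stub_nearMaxMostTimes` LITERALLY (its signature is the conclusion), with threshold `M := A·m₀`
  (the planner's `nearMaxMostTimesDoor_of_law`);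
* `threadingFluxTarget_of_universalAmplifiedWindowAlignment` — UAW ⇒ hard core `ThreadingFlux.Target`
  (stmt-1217: no Type-I first blow-up in the class), through `false_of_nearMaxMostTimesBulkAligned_typeI`;
* `aprioriMostTimesBulkAlignment_of_universalAmplifiedWindowAlignment_of_typeIIResidue` — UAW ∧ R_II (the
  line's shared STUB 2) ⇒ the CRUX `AprioriMostTimesBulkAlignment` by name
  (`aprioriMostTimesBulkAlignment_iff_target_and_typeII`);
* `navierStokesRegularity_of_universalAmplifiedWindowAlignment_of_noTypeII` — UAW ∧ NoTypeII (the route's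
  residual, stmt-0056) ⇒ Clay (A) (the planner's `closesT`).

So a CONFIRM of the typed law UAW decides the registered stub, the crux and — with the residual — the route's
summit claim; a certified REFUTATION of UAW on one regular flow kills this glue path (not the stub). The
BUDGET-currency law UDW∞ (Form M) is glued through the flow-side portrait
`typeI_uniform_window_budget_decoherence` (`ScaledTopAlignmentTypeIBlowupBudgetPortrait`) in a sibling file.
hard core evaded: none — UAW IMPLIES Target (1217); NoTypeII (0056) stays the residual. WHAT THIS IS NOT: not NS
regularity and not a proof of UAW or of the stub; composition of landed results with a frontier law as
hypothesis. [folklore]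
-/

noncomputable section

-- the summit and its single sub-problem share the name (CONVENTIONS §1), as in every Theorems file
set_option linter.dupNamespace false

open MeasureTheory Set Function Filter Topology Metric
open scoped RealInnerProductSpace ENNReal
open Literature.Analysis Literature.Analysis.FluidPDE

namespace Summit.NavierStokesRegularity.NavierStokesRegularity.Theorems

/-! ### Form T: the universal amplified-window alignment law -/

/-- Rapidly decaying data have bounded vorticity: a bound `m₀ > 0` of `‖curl u₀‖` (`HasRapidSpatialDecay` at
`n = 1`, `K = 0`, and `‖curl v x‖ ≤ ‖curlCLM‖ ‖Dv(x)‖`). [folklore] -/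
theorem exists_bound_curl_of_rapidDecay {u0 : EuclideanSpace ℝ (Fin 3) → EuclideanSpace ℝ (Fin 3)}
    (hdec : HasRapidSpatialDecay u0) : ∃ m0 : ℝ, 0 < m0 ∧ ∀ x, ‖curl u0 x‖ ≤ m0 := by
  -- adapted from the cell file nsreg-p3 round-10/Law10-rev2.lean (`exists_bound_curl_of_rapidDecay`)
  obtain ⟨C, hC⟩ := hdec 1 0
  refine ⟨max 1 (‖curlCLM‖ * C), lt_of_lt_of_le one_pos (le_max_left _ _), fun x => ?_⟩
  have h1 : ‖iteratedFDeriv ℝ 1 u0 x‖ ≤ C := by simpa using hC x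
  have h2 : ‖fderiv ℝ u0 x‖ ≤ C := by rw [← norm_iteratedFDeriv_one]; exact h1
  have h3 : ‖curl u0 x‖ ≤ ‖curlCLM‖ * ‖fderiv ℝ u0 x‖ := norm_curl_le u0 x
  have h4 : ‖curlCLM‖ * ‖fderiv ℝ u0 x‖ ≤ ‖curlCLM‖ * C := mul_le_mul_of_nonneg_left h2 (norm_nonneg curlCLM)
  exact h3.trans (h4.trans (le_max_right _ _))

/-- **UAW ⇒ STUB 1 of line `nearmax`.** The universal amplified-window alignment law (inline hypothesis = the
body of the planner's `UniversalAmplifiedWindowAlignment`: universal `λ₀ < 1`, `R₀ > 0`, `θ < 1` and, per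
`(q, ε, δ)`, a universal gate `A` such that in every classical Leray–Hopf flow from rapidly decaying data with
`‖curl u₀‖ ≤ m₀`, outside exceptional times of final density `≤ θ`, every `A·m₀`-amplified `q`-near-maximal point
has an `ε`-misaligned `λ₀`-top part of its `R₀ℓ`-window of volume `≤ δℓ³`) implies the per-solution
near-maximum most-times door W3ⁿᵐ — LITERALLY the signature of the registered stub `Nearmax.stub_nearMaxMostTimes`
— with threshold `M := A(q,ε,δ)·m₀`; the rate premise of the door is not used. [folklore] -/
theorem nearMaxMostTimesDoor_of_universalAmplifiedWindowAlignment
    (hL : ∃ lam0 : ℝ, lam0 < 1 ∧ ∃ R0 : ℝ, 0 < R0 ∧ ∃ θ : ℝ, θ < 1 ∧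
      ∀ q : ℝ, 0 < q → ∀ ε : ℝ, 0 < ε → ∀ δ : ℝ, 0 < δ → ∃ A : ℝ, 0 < A ∧
        ∀ (ν T : ℝ), 0 < ν → 0 < T → ∀ (u : ℝ → EuclideanSpace ℝ (Fin 3) → EuclideanSpace ℝ (Fin 3))
          (p : ℝ → EuclideanSpace ℝ (Fin 3) → ℝ),
          IsClassicalNSSolutionOn (Set.Ico 0 T) ν 0 u p → IsLerayHopfOn T ν 0 (u 0) u → HasRapidSpatialDecay (u 0) →
          ∀ m0 : ℝ, 0 < m0 → (∀ x, ‖curl (u 0) x‖ ≤ m0) →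
            ∃ E : Set ℝ, (∃ h0 : ℝ, 0 < h0 ∧ ∀ h : ℝ, 0 < h → h < h0 →
                volume (E ∩ Set.Ioo (T - h) T) ≤ ENNReal.ofReal (θ * h)) ∧
              ∀ t ∈ Set.Ico 0 T, t ∉ E → ∀ x : EuclideanSpace ℝ (Fin 3), A * m0 ≤ ‖curl (u t) x‖ →
                (∀ x' : EuclideanSpace ℝ (Fin 3), q * ‖curl (u t) x'‖ ≤ ‖curl (u t) x‖) →
                volume {y : EuclideanSpace ℝ (Fin 3) | lam0 * ‖curl (u t) x‖ ≤ ‖curl (u t) y‖ ∧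
                    ‖x - y‖ ≤ R0 * Real.sqrt (ν / ‖curl (u t) x‖) ∧
                    ε < Real.sqrt (1 - (inner ℝ (‖curl (u t) x‖⁻¹ • curl (u t) x)
                      (‖curl (u t) y‖⁻¹ • curl (u t) y)) ^ 2)}
                  ≤ ENNReal.ofReal (δ * Real.sqrt (ν / ‖curl (u t) x‖) ^ 3)) :
    ∀ (ν T : ℝ), 0 < ν → 0 < T → ∀ (u : ℝ → EuclideanSpace ℝ (Fin 3) → EuclideanSpace ℝ (Fin 3))
      (p : ℝ → EuclideanSpace ℝ (Fin 3) → ℝ), IsClassicalNSSolutionOn (Set.Ico 0 T) ν 0 u p →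
      IsLerayHopfOn T ν 0 (u 0) u → HasRapidSpatialDecay (u 0) →
      ∃ lam0 : ℝ, lam0 < 1 ∧ ∃ R0 : ℝ, 0 < R0 ∧ ∃ θ : ℝ, θ < 1 ∧ ∀ κ : ℝ, 0 < κ → ∀ q : ℝ, 0 < q →
        ∀ ε : ℝ, 0 < ε → ∀ δ : ℝ, 0 < δ → ∃ M : ℝ, 0 < M ∧ ∃ E : Set ℝ,
        (∃ h0 : ℝ, 0 < h0 ∧ ∀ h : ℝ, 0 < h → h < h0 →
          MeasureTheory.volume (E ∩ Set.Ioo (T - h) T) ≤ ENNReal.ofReal (θ * h)) ∧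
        ∀ t ∈ Set.Ico 0 T, t ∉ E → ∀ x : EuclideanSpace ℝ (Fin 3), M ≤ ‖curl (u t) x‖ →
        κ / (T - t) ≤ ‖curl (u t) x‖ → (∀ x' : EuclideanSpace ℝ (Fin 3), q * ‖curl (u t) x'‖ ≤ ‖curl (u t) x‖) →
          MeasureTheory.volume {y : EuclideanSpace ℝ (Fin 3) | lam0 * ‖curl (u t) x‖ ≤ ‖curl (u t) y‖ ∧
              ‖x - y‖ ≤ R0 * Real.sqrt (ν / ‖curl (u t) x‖) ∧
              ε < Real.sqrt (1 - (inner ℝ (‖curl (u t) x‖⁻¹ • curl (u t) x)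
                (‖curl (u t) y‖⁻¹ • curl (u t) y)) ^ 2)}
            ≤ ENNReal.ofReal (δ * Real.sqrt (ν / ‖curl (u t) x‖) ^ 3) := by
  -- adapted from the cell file nsreg-p3 round-10/Law10-rev2.lean (`nearMaxMostTimesDoor_of_law`)
  intro ν T hν hT u p hcl hLH hdec
  obtain ⟨lam0, hlam01, R0, hR0, θ, hθ, hfam⟩ := hL
  obtain ⟨m0, hm0, hbd⟩ := exists_bound_curl_of_rapidDecay hdec
  refine ⟨lam0, hlam01, R0, hR0, θ, hθ, fun κ _ q hq ε hε δ hδ => ?_⟩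
  obtain ⟨A, hA, hA'⟩ := hfam q hq ε hε δ hδ
  obtain ⟨E, hE, hgood⟩ := hA' ν T hν hT u p hcl hLH hdec m0 hm0 hbd
  exact ⟨A * m0, mul_pos hA hm0, E, hE, fun t ht htE x hM _ hq' => hgood t ht htE x hM hq'⟩

/-- **UAW ⇒ the hard core `ThreadingFlux.Target`** (stmt-NavierStokesRegularity-1217: no Type-I first blow-up
in the class): per solution, the door W3ⁿᵐ supplied by the law kills a Type-I first blow-up
(`false_of_nearMaxMostTimesBulkAligned_typeI`; slab bounds `slabBound_of_classical_lerayHopf`). [folklore] -/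
theorem threadingFluxTarget_of_universalAmplifiedWindowAlignment
    (hL : ∃ lam0 : ℝ, lam0 < 1 ∧ ∃ R0 : ℝ, 0 < R0 ∧ ∃ θ : ℝ, θ < 1 ∧
      ∀ q : ℝ, 0 < q → ∀ ε : ℝ, 0 < ε → ∀ δ : ℝ, 0 < δ → ∃ A : ℝ, 0 < A ∧
        ∀ (ν T : ℝ), 0 < ν → 0 < T → ∀ (u : ℝ → EuclideanSpace ℝ (Fin 3) → EuclideanSpace ℝ (Fin 3))
          (p : ℝ → EuclideanSpace ℝ (Fin 3) → ℝ),
          IsClassicalNSSolutionOn (Set.Ico 0 T) ν 0 u p → IsLerayHopfOn T ν 0 (u 0) u → HasRapidSpatialDecay (u 0) →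
          ∀ m0 : ℝ, 0 < m0 → (∀ x, ‖curl (u 0) x‖ ≤ m0) →
            ∃ E : Set ℝ, (∃ h0 : ℝ, 0 < h0 ∧ ∀ h : ℝ, 0 < h → h < h0 →
                volume (E ∩ Set.Ioo (T - h) T) ≤ ENNReal.ofReal (θ * h)) ∧
              ∀ t ∈ Set.Ico 0 T, t ∉ E → ∀ x : EuclideanSpace ℝ (Fin 3), A * m0 ≤ ‖curl (u t) x‖ →
                (∀ x' : EuclideanSpace ℝ (Fin 3), q * ‖curl (u t) x'‖ ≤ ‖curl (u t) x‖) →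
                volume {y : EuclideanSpace ℝ (Fin 3) | lam0 * ‖curl (u t) x‖ ≤ ‖curl (u t) y‖ ∧
                    ‖x - y‖ ≤ R0 * Real.sqrt (ν / ‖curl (u t) x‖) ∧
                    ε < Real.sqrt (1 - (inner ℝ (‖curl (u t) x‖⁻¹ • curl (u t) x)
                      (‖curl (u t) y‖⁻¹ • curl (u t) y)) ^ 2)}
                  ≤ ENNReal.ofReal (δ * Real.sqrt (ν / ‖curl (u t) x‖) ^ 3)) :
    Summit.NavierStokesRegularity.NavierStokesRegularity.Theses.ThreadingFlux.Target := by
  intro ν T hν hT u p hcl hLH hdec hI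
  by_contra hext
  obtain ⟨lam0, hlam01, R0, hR0, θ, hθ, hfam⟩ :=
    nearMaxMostTimesDoor_of_universalAmplifiedWindowAlignment hL ν T hν hT u p hcl hLH hdec
  exact false_of_nearMaxMostTimesBulkAligned_typeI hν hT hcl hLH hdec
    (slabBound_of_classical_lerayHopf hν hT hcl hLH hdec) hI hext hlam01 hR0 hθ hfam

/-- **UAW ∧ R_II ⇒ the CRUX by name.** With the Type-II residue R_II (the line's STUB 2 `stub_typeIIResidue`,
shared with `Lines/recurrent.lean`; vacuous under the route's residual NoTypeII) the law gives the deciding crux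
`AprioriMostTimesBulkAlignment` (stmt-NavierStokesRegularity-19551) through the landed equivalence
`aprioriMostTimesBulkAlignment_iff_target_and_typeII`. [folklore] -/
theorem aprioriMostTimesBulkAlignment_of_universalAmplifiedWindowAlignment_of_typeIIResidue
    (hL : ∃ lam0 : ℝ, lam0 < 1 ∧ ∃ R0 : ℝ, 0 < R0 ∧ ∃ θ : ℝ, θ < 1 ∧
      ∀ q : ℝ, 0 < q → ∀ ε : ℝ, 0 < ε → ∀ δ : ℝ, 0 < δ → ∃ A : ℝ, 0 < A ∧
        ∀ (ν T : ℝ), 0 < ν → 0 < T → ∀ (u : ℝ → EuclideanSpace ℝ (Fin 3) → EuclideanSpace ℝ (Fin 3))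
          (p : ℝ → EuclideanSpace ℝ (Fin 3) → ℝ),
          IsClassicalNSSolutionOn (Set.Ico 0 T) ν 0 u p → IsLerayHopfOn T ν 0 (u 0) u → HasRapidSpatialDecay (u 0) →
          ∀ m0 : ℝ, 0 < m0 → (∀ x, ‖curl (u 0) x‖ ≤ m0) →
            ∃ E : Set ℝ, (∃ h0 : ℝ, 0 < h0 ∧ ∀ h : ℝ, 0 < h → h < h0 →
                volume (E ∩ Set.Ioo (T - h) T) ≤ ENNReal.ofReal (θ * h)) ∧
              ∀ t ∈ Set.Ico 0 T, t ∉ E → ∀ x : EuclideanSpace ℝ (Fin 3), A * m0 ≤ ‖curl (u t) x‖ →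
                (∀ x' : EuclideanSpace ℝ (Fin 3), q * ‖curl (u t) x'‖ ≤ ‖curl (u t) x‖) →
                volume {y : EuclideanSpace ℝ (Fin 3) | lam0 * ‖curl (u t) x‖ ≤ ‖curl (u t) y‖ ∧
                    ‖x - y‖ ≤ R0 * Real.sqrt (ν / ‖curl (u t) x‖) ∧
                    ε < Real.sqrt (1 - (inner ℝ (‖curl (u t) x‖⁻¹ • curl (u t) x)
                      (‖curl (u t) y‖⁻¹ • curl (u t) y)) ^ 2)}
                  ≤ ENNReal.ofReal (δ * Real.sqrt (ν / ‖curl (u t) x‖) ^ 3))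
    (hRII : ∀ (ν T : ℝ), 0 < ν → 0 < T → ∀ (u : ℝ → EuclideanSpace ℝ (Fin 3) → EuclideanSpace ℝ (Fin 3))
        (p : ℝ → EuclideanSpace ℝ (Fin 3) → ℝ),
        IsClassicalNSSolutionOn (Set.Ico 0 T) ν 0 u p → IsLerayHopfOn T ν 0 (u 0) u →
        HasRapidSpatialDecay (u 0) → ¬ HasSmoothExtensionPast ν 0 u T → ¬ IsTypeIBlowup u T →
        ∃ lam0 : ℝ, lam0 < 1 ∧ ∃ R0 : ℝ, 0 < R0 ∧ ∃ θ : ℝ, θ < 1 ∧ ∀ κ : ℝ, 0 < κ → ∀ ε : ℝ, 0 < ε →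
          ∀ δ : ℝ, 0 < δ → ∃ M : ℝ, 0 < M ∧ ∃ E : Set ℝ,
            (∃ h0 : ℝ, 0 < h0 ∧ ∀ h : ℝ, 0 < h → h < h0 →
              volume (E ∩ Set.Ioo (T - h) T) ≤ ENNReal.ofReal (θ * h)) ∧
            ∀ t ∈ Set.Ico 0 T, t ∉ E → ∀ x : EuclideanSpace ℝ (Fin 3), M ≤ ‖curl (u t) x‖ →
              κ / (T - t) ≤ ‖curl (u t) x‖ →
              volume {y : EuclideanSpace ℝ (Fin 3) | lam0 * ‖curl (u t) x‖ ≤ ‖curl (u t) y‖ ∧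
                  ‖x - y‖ ≤ R0 * Real.sqrt (ν / ‖curl (u t) x‖) ∧
                  ε < Real.sqrt (1 - (inner ℝ (‖curl (u t) x‖⁻¹ • curl (u t) x)
                    (‖curl (u t) y‖⁻¹ • curl (u t) y)) ^ 2)}
                ≤ ENNReal.ofReal (δ * Real.sqrt (ν / ‖curl (u t) x‖) ^ 3)) :
    Summit.NavierStokesRegularity.NavierStokesRegularity.Theses.ScaledTopAlignment.AprioriMostTimesBulkAlignment :=
  aprioriMostTimesBulkAlignment_iff_target_and_typeII.mpr
    ⟨threadingFluxTarget_of_universalAmplifiedWindowAlignment hL, hRII⟩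

/-- **UAW ∧ NoTypeII ⇒ Clay (A)** (the planner's `closesT`): the universal law and the route's residual hard
core NoTypeII (stmt-NavierStokesRegularity-0056, in the route's own spelling
`Theses.ScaledTopAlignment.NoTypeII`) give `NavierStokesRegularity`, through the landed bridge
`navierStokesRegularity_of_nearMaxMostTimesBulkAlignment_of_noTypeII`. [folklore] -/
theorem navierStokesRegularity_of_universalAmplifiedWindowAlignment_of_noTypeII
    (hL : ∃ lam0 : ℝ, lam0 < 1 ∧ ∃ R0 : ℝ, 0 < R0 ∧ ∃ θ : ℝ, θ < 1 ∧
      ∀ q : ℝ, 0 < q → ∀ ε : ℝ, 0 < ε → ∀ δ : ℝ, 0 < δ → ∃ A : ℝ, 0 < A ∧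
        ∀ (ν T : ℝ), 0 < ν → 0 < T → ∀ (u : ℝ → EuclideanSpace ℝ (Fin 3) → EuclideanSpace ℝ (Fin 3))
          (p : ℝ → EuclideanSpace ℝ (Fin 3) → ℝ),
          IsClassicalNSSolutionOn (Set.Ico 0 T) ν 0 u p → IsLerayHopfOn T ν 0 (u 0) u → HasRapidSpatialDecay (u 0) →
          ∀ m0 : ℝ, 0 < m0 → (∀ x, ‖curl (u 0) x‖ ≤ m0) →
            ∃ E : Set ℝ, (∃ h0 : ℝ, 0 < h0 ∧ ∀ h : ℝ, 0 < h → h < h0 →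
                volume (E ∩ Set.Ioo (T - h) T) ≤ ENNReal.ofReal (θ * h)) ∧
              ∀ t ∈ Set.Ico 0 T, t ∉ E → ∀ x : EuclideanSpace ℝ (Fin 3), A * m0 ≤ ‖curl (u t) x‖ →
                (∀ x' : EuclideanSpace ℝ (Fin 3), q * ‖curl (u t) x'‖ ≤ ‖curl (u t) x‖) →
                volume {y : EuclideanSpace ℝ (Fin 3) | lam0 * ‖curl (u t) x‖ ≤ ‖curl (u t) y‖ ∧
                    ‖x - y‖ ≤ R0 * Real.sqrt (ν / ‖curl (u t) x‖) ∧
                    ε < Real.sqrt (1 - (inner ℝ (‖curl (u t) x‖⁻¹ • curl (u t) x)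
                      (‖curl (u t) y‖⁻¹ • curl (u t) y)) ^ 2)}
                  ≤ ENNReal.ofReal (δ * Real.sqrt (ν / ‖curl (u t) x‖) ^ 3))
    (hII : Summit.NavierStokesRegularity.NavierStokesRegularity.Theses.ScaledTopAlignment.NoTypeII) :
    NavierStokesRegularity :=
  navierStokesRegularity_of_nearMaxMostTimesBulkAlignment_of_noTypeII
    (nearMaxMostTimesDoor_of_universalAmplifiedWindowAlignment hL) hII

end Summit.NavierStokesRegularity.NavierStokesRegularity.Theorems

end
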